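import Literature.NumberTheory.EllipticCurves.PAdicLFunctionTameEulerFactorProofs
import Literature.NumberTheory.EllipticCurves.BurungaleSkinner2023.RootNumberLambdaParityProofs
import HarnessLib

/-!
# Matsuno 2000, Lemma 3.3 as an identity of POWER SERIES and its iteration over the primes of a squarefree
# tame level: `L_p(f,α,𝟙_{mℓ}) = (a_ℓ − (1+T)^{−c_ℓ} − (1+T)^{c_ℓ}) · L_p(f,α,𝟙_m)` and
# `L_p(f,α,𝟙_{∏ℓ}) = ∏_ℓ (a_ℓ − (1+T)^{−c_ℓ} − (1+T)^{c_ℓ}) · L_p(f,α)` (PROOFS ONLY)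

Cell bsd-2adic, seat conv-1 (planner RULING RC-159; the `m`-DEPLETION half of the congruence `hcong`). The landed
`padicLCoeffTame_mul_prime` (`PAdicLFunctionTameEulerFactorProofs`) is Matsuno's Lemma 3.3 (J. Number Theory 84 (2000),
pp. 87–88; trivial tame character, good prime `ℓ ∤ pmN`) coefficientwise. Here it is repackaged:

* `padicLFunctionTame_mul_prime` — the same as ONE identity in `ℚ_p⟦T⟧`:
  `L_p(f,α,𝟙_{mℓ}) = (C a_ℓ − (1+T)^{−c} − (1+T)^{c}) · L_p(f,α,𝟙_m)`, `(1+T)^{c} = binomialSeries ℚ_p c`, `ℓ ≡ η_ℓ γ^{c}`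
  (Cauchy product `coeff_C_mul_binomialSeries_mul`);
* `iwasawaToPowerSeries_tameEulerFactor_mul` (with `BurungaleSkinner2023.iwasawaToPowerSeries_binomialSeries`) — the factor
  `h_ℓ = C a_ℓ − (1+T)^{−c} − (1+T)^{c}` lies in `Λ = ℤ_p⟦T⟧`, so an integral lift `G` of `L_p(f,α,𝟙_m)` gives the
  integral lift `h_ℓ · G` of `L_p(f,α,𝟙_{mℓ})`;
* **`padicLFunctionTame_prod_primes`** — for a finite set `S` of primes `ℓ ∤ N`, `ℓ ≠ p`, and `m = ∏_{ℓ∈S} ℓ`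
  (squarefree tame level): `L_p(f,α,𝟙_m) = (∏_{ℓ∈S} h_ℓ) · L_p(f,α)` (induction on `S`, anchor `padicLFunctionTame_one`),
  Matsuno's "`G_{p,m}(E, 1, T) = ∏_{ℓ | m} (…) G_p(E, T)`" (proof of Thm. 3.1, p. 88) in the tree's normalisation;
  `iwasawaToPowerSeries_prod_tameEulerFactor_mul` its `Λ`-form.

References: K. Matsuno, J. Number Theory 84 (2000), Lemma 3.3 and proof of Thm. 3.1 (pp. 87–88) [Matsuno2000];
B. Mazur, J. Tate, J. Teitelbaum, Invent. Math. 84 (1986), §I.13 [MazurTateTeitelbaum1986Invent].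
-/

noncomputable section

open scoped MatrixGroups ModularForm

open CongruenceSubgroup Filter Topology PowerSeries Literature.NumberTheory.EllipticCurves.ModularForms

namespace Literature.NumberTheory.EllipticCurves

section Series

variable {N : ℕ} [NeZero N] {f : CuspForm (Gamma0 N) 2} {p : ℕ} [Fact p.Prime] {m ℓ : ℕ} [NeZero m] [NeZero (m * ℓ)]

/-- **Matsuno 2000, Lemma 3.3 as an identity of power series**: under the hypotheses of `padicLCoeffTame_mul_prime`,
`L_p(f,α,𝟙_{mℓ}) = (C a_ℓ − (1+T)^{−c} − (1+T)^{c}) · L_p(f,α,𝟙_m)` in `ℚ_p⟦T⟧`, with `(1+T)^{±c}` Mathlib's binomial series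
over the binomial ring `ℤ_p` and `ℓ ≡ η_ℓ γ^{c}`. [cite: Matsuno2000, Lemma 3.3 (pp. 87–88)] -/
theorem padicLFunctionTame_mul_prime (hf : IsNewform0 f) (hQ : coeffField f = ⊥) (hpN : ¬ p ∣ N) (hmp : m.Coprime p)
    {ap : ℤ} (hap : cuspCoeff f p = ap) {α : ℚ_[p]} (hα : α ^ 2 - ap * α + p = 0) (hαu : ‖α‖ = 1)
    (hℓ : ℓ.Prime) (hℓN : ¬ ℓ ∣ N) {aℓ : ℤ} (haℓ : cuspCoeff f ℓ = aℓ) (hℓp : ℓ.Coprime p) (hℓm : ℓ.Coprime m)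
    {teich : rootsOfUnity (torsionOrder p) ℤ_[p]} {c : ℤ_[p]}
    (hc : ∀ n : ℕ, PadicInt.toZModPow (n + cyclotomicExponent p) ((teich : ℤ_[p]ˣ) : ℤ_[p]) *
        (cyclotomicGenerator p : ZMod (p ^ (n + cyclotomicExponent p))) ^ (PadicInt.toZModPow n c).val =
          (ℓ : ZMod (p ^ (n + cyclotomicExponent p)))) :
    padicLFunctionTame f (m * ℓ) α 1 =
      (C (aℓ : ℚ_[p]) - PowerSeries.binomialSeries ℚ_[p] (-c) - PowerSeries.binomialSeries ℚ_[p] c) *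
        padicLFunctionTame f m α 1 := by
  ext k
  have hB : ∀ c' : ℤ_[p], coeff k (PowerSeries.binomialSeries ℚ_[p] c' * padicLFunctionTame f m α 1) =
      ∑ i ∈ Finset.range (k + 1), algebraMap ℤ_[p] ℚ_[p] (Ring.choose c' (k - i)) * padicLCoeffTame f m α 1 i := by
    intro c'
    have h := coeff_C_mul_binomialSeries_mul 1 c' (padicLFunctionTame f m α 1) k
    rw [map_one, one_mul, one_mul] at h
    rw [h]
    refine Finset.sum_congr rfl fun i _ ↦ ?_
    rw [coeff_padicLFunctionTame]
  rw [coeff_padicLFunctionTame, padicLCoeffTame_mul_prime hf hQ hpN hmp hap hα hαu hℓ hℓN haℓ hℓp hℓm hc k,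
    sub_mul, sub_mul, map_sub, map_sub, coeff_C_mul, coeff_padicLFunctionTame, hB, hB]

omit [NeZero m] [NeZero (m * ℓ)] in
/-- `ι(C z) = C z` for an integer constant (`PowerSeries.map_C`); private helper. [folklore] -/
private theorem iwasawaToPowerSeries_C_intCast (z : ℤ) :
    iwasawaToPowerSeries p (C (z : ℤ_[p])) = C (z : ℚ_[p]) := by
  show PowerSeries.map _ (C _) = _
  rw [PowerSeries.map_C, map_intCast]

/-- **The factor `h_ℓ = a_ℓ − (1+T)^{−c} − (1+T)^{c}` is integral**: if `G ∈ Λ` lifts `L_p(f,α,𝟙_m)` (`ι G = L_p(f,α,𝟙_m)`), then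
`(C a_ℓ − (1+T)^{−c} − (1+T)^{c}) · G ∈ Λ` lifts `L_p(f,α,𝟙_{mℓ})` (Lemma 3.3 read in `Λ = ℤ_p⟦T⟧`).
[cite: Matsuno2000, Lemma 3.3 (pp. 87–88)] -/
theorem iwasawaToPowerSeries_tameEulerFactor_mul (hf : IsNewform0 f) (hQ : coeffField f = ⊥) (hpN : ¬ p ∣ N)
    (hmp : m.Coprime p) {ap : ℤ} (hap : cuspCoeff f p = ap) {α : ℚ_[p]} (hα : α ^ 2 - ap * α + p = 0)
    (hαu : ‖α‖ = 1) (hℓ : ℓ.Prime) (hℓN : ¬ ℓ ∣ N) {aℓ : ℤ} (haℓ : cuspCoeff f ℓ = aℓ) (hℓp : ℓ.Coprime p)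
    (hℓm : ℓ.Coprime m) {teich : rootsOfUnity (torsionOrder p) ℤ_[p]} {c : ℤ_[p]}
    (hc : ∀ n : ℕ, PadicInt.toZModPow (n + cyclotomicExponent p) ((teich : ℤ_[p]ˣ) : ℤ_[p]) *
        (cyclotomicGenerator p : ZMod (p ^ (n + cyclotomicExponent p))) ^ (PadicInt.toZModPow n c).val =
          (ℓ : ZMod (p ^ (n + cyclotomicExponent p))))
    {G : IwasawaAlgebra p} (hG : iwasawaToPowerSeries p G = padicLFunctionTame f m α 1) :
    iwasawaToPowerSeries p
        ((C (aℓ : ℤ_[p]) - PowerSeries.binomialSeries ℤ_[p] (-c) - PowerSeries.binomialSeries ℤ_[p] c) * G) =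
      padicLFunctionTame f (m * ℓ) α 1 := by
  rw [map_mul, map_sub, map_sub, hG, BurungaleSkinner2023.iwasawaToPowerSeries_binomialSeries,
    BurungaleSkinner2023.iwasawaToPowerSeries_binomialSeries,
    iwasawaToPowerSeries_C_intCast, padicLFunctionTame_mul_prime hf hQ hpN hmp hap hα hαu hℓ hℓN haℓ hℓp hℓm hc]

end Series

/-! ### Iteration over the primes of a squarefree tame level -/

section Product

variable {N : ℕ} [NeZero N] {f : CuspForm (Gamma0 N) 2} {p : ℕ} [Fact p.Prime]

/-- **Depletion at a squarefree tame level** (Matsuno 2000, proof of Thm. 3.1 via Lemma 3.3): for a finite set `S` of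
primes `ℓ ∤ N`, `ℓ ≠ p`, with `a_ℓ(f) = a ℓ` and Teichmüller–exponent data `ℓ ≡ η_ℓ γ^{c ℓ}`, and `m = ∏_{ℓ∈S} ℓ`:
`L_p(f,α,𝟙_m) = (∏_{ℓ∈S} (C a_ℓ − (1+T)^{−c_ℓ} − (1+T)^{c_ℓ})) · L_p(f,α)` in `ℚ_p⟦T⟧` (induction on `S`; anchor
`padicLFunctionTame_one`). [cite: Matsuno2000, Lemma 3.3 and proof of Theorem 3.1 (pp. 87–88)] -/
theorem padicLFunctionTame_prod_primes (hf : IsNewform0 f) (hQ : coeffField f = ⊥) (hpN : ¬ p ∣ N)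
    {ap : ℤ} (hap : cuspCoeff f p = ap) {α : ℚ_[p]} (hα : α ^ 2 - ap * α + p = 0) (hαu : ‖α‖ = 1)
    {a : ℕ → ℤ} {teich : ℕ → rootsOfUnity (torsionOrder p) ℤ_[p]} {c : ℕ → ℤ_[p]} :
    ∀ (S : Finset ℕ), (∀ ℓ ∈ S, ℓ.Prime ∧ ¬ ℓ ∣ N ∧ ℓ.Coprime p) → (∀ ℓ ∈ S, cuspCoeff f ℓ = a ℓ) →
      (∀ ℓ ∈ S, ∀ n : ℕ, PadicInt.toZModPow (n + cyclotomicExponent p) ((teich ℓ : ℤ_[p]ˣ) : ℤ_[p]) *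
        (cyclotomicGenerator p : ZMod (p ^ (n + cyclotomicExponent p))) ^ (PadicInt.toZModPow n (c ℓ)).val =
          (ℓ : ZMod (p ^ (n + cyclotomicExponent p)))) →
      ∀ (m : ℕ) [NeZero m], m = ∏ ℓ ∈ S, ℓ →
        padicLFunctionTame f m α 1 =
          (∏ ℓ ∈ S, (C ((a ℓ : ℤ) : ℚ_[p]) - PowerSeries.binomialSeries ℚ_[p] (-c ℓ) -
              PowerSeries.binomialSeries ℚ_[p] (c ℓ))) * padicLFunction f α := by
  classical
  intro S
  induction S using Finset.induction_on with
  | empty =>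
    intro _ _ _ m _ hm
    rw [Finset.prod_empty] at hm
    subst hm
    rw [Finset.prod_empty, one_mul, padicLFunctionTame_one]
  | @insert ℓ₀ S hℓ₀ ih =>
    intro hS ha hc m _ hm
    have hm' : m = (∏ ℓ ∈ S, ℓ) * ℓ₀ := by
      rw [hm, ← Finset.prod_erase_mul _ _ (Finset.mem_insert_self ℓ₀ S), Finset.erase_insert hℓ₀]
    subst hm'
    have hS' : ∀ ℓ ∈ S, ℓ.Prime ∧ ¬ ℓ ∣ N ∧ ℓ.Coprime p := fun ℓ h ↦ hS ℓ (Finset.mem_insert_of_mem h)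
    obtain ⟨hℓ₀p, hℓ₀N, hℓ₀cp⟩ := hS ℓ₀ (Finset.mem_insert_self ℓ₀ S)
    haveI : NeZero (∏ ℓ ∈ S, ℓ) :=
      ⟨Finset.prod_ne_zero_iff.mpr fun ℓ h ↦ (hS' ℓ h).1.ne_zero⟩
    have hmp : (∏ ℓ ∈ S, ℓ).Coprime p := Nat.Coprime.prod_left fun ℓ h ↦ (hS' ℓ h).2.2
    have hℓm : ℓ₀.Coprime (∏ ℓ ∈ S, ℓ) := by
      refine Nat.Coprime.prod_right fun ℓ h ↦ (Nat.coprime_primes hℓ₀p (hS' ℓ h).1).mpr ?_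
      rintro rfl
      exact hℓ₀ h
    rw [Finset.prod_insert hℓ₀, mul_assoc,
      ← ih hS' (fun ℓ h ↦ ha ℓ (Finset.mem_insert_of_mem h)) (fun ℓ h ↦ hc ℓ (Finset.mem_insert_of_mem h)) _ rfl]
    exact padicLFunctionTame_mul_prime hf hQ hpN hmp hap hα hαu hℓ₀p hℓ₀N (ha ℓ₀ (Finset.mem_insert_self ℓ₀ S))
      hℓ₀cp hℓm (hc ℓ₀ (Finset.mem_insert_self ℓ₀ S))

/-- **`Λ`-form of the depletion at a squarefree tame level**: with `S`, `m = ∏_{ℓ∈S} ℓ` as in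
`padicLFunctionTame_prod_primes` and `G ∈ Λ` an integral lift of `L_p(f,α)` (`ι G = L_p(f,α)`), the element
`(∏_{ℓ∈S} (C a_ℓ − (1+T)^{−c_ℓ} − (1+T)^{c_ℓ})) · G ∈ Λ` lifts `L_p(f,α,𝟙_m)`. [cite: Matsuno2000, Lemma 3.3 and proof of Theorem 3.1 (pp. 87–88)] -/
theorem iwasawaToPowerSeries_prod_tameEulerFactor_mul (hf : IsNewform0 f) (hQ : coeffField f = ⊥) (hpN : ¬ p ∣ N)
    {ap : ℤ} (hap : cuspCoeff f p = ap) {α : ℚ_[p]} (hα : α ^ 2 - ap * α + p = 0) (hαu : ‖α‖ = 1)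
    {a : ℕ → ℤ} {teich : ℕ → rootsOfUnity (torsionOrder p) ℤ_[p]} {c : ℕ → ℤ_[p]} {S : Finset ℕ}
    (hS : ∀ ℓ ∈ S, ℓ.Prime ∧ ¬ ℓ ∣ N ∧ ℓ.Coprime p) (ha : ∀ ℓ ∈ S, cuspCoeff f ℓ = a ℓ)
    (hc : ∀ ℓ ∈ S, ∀ n : ℕ, PadicInt.toZModPow (n + cyclotomicExponent p) ((teich ℓ : ℤ_[p]ˣ) : ℤ_[p]) *
        (cyclotomicGenerator p : ZMod (p ^ (n + cyclotomicExponent p))) ^ (PadicInt.toZModPow n (c ℓ)).val =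
          (ℓ : ZMod (p ^ (n + cyclotomicExponent p))))
    {m : ℕ} [NeZero m] (hm : m = ∏ ℓ ∈ S, ℓ) {G : IwasawaAlgebra p}
    (hG : iwasawaToPowerSeries p G = padicLFunction f α) :
    iwasawaToPowerSeries p
        ((∏ ℓ ∈ S, (C ((a ℓ : ℤ) : ℤ_[p]) - PowerSeries.binomialSeries ℤ_[p] (-c ℓ) -
            PowerSeries.binomialSeries ℤ_[p] (c ℓ))) * G) = padicLFunctionTame f m α 1 := by
  rw [map_mul, map_prod, hG, padicLFunctionTame_prod_primes hf hQ hpN hap hα hαu S hS ha hc m hm]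
  congr 1
  refine Finset.prod_congr rfl fun ℓ _ ↦ ?_
  rw [map_sub, map_sub, BurungaleSkinner2023.iwasawaToPowerSeries_binomialSeries,
    BurungaleSkinner2023.iwasawaToPowerSeries_binomialSeries,
    iwasawaToPowerSeries_C_intCast]

end Product

end Literature.NumberTheory.EllipticCurves

end
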